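import Literature.MathematicalPhysics.QuantumFieldTheory.BalabanImbrieJaffe1984to88.BIJ88W6PrimeVsuppBound

/-!
# `BalabanImbrieJaffe1984to88.BIJ88Eq5145CornerW6` — T. Bałaban, J. Imbrie, A. Jaffe, *Effective action and cluster properties of the abelian Higgs
model*, Commun. Math. Phys. **114** (1988) 257–315 [BalabanImbrieJaffe1988], Sect. 5.14, (5.14.5) p. 312 [PDF 56] with p. 310 display 4 and the
p. 310 bound: **(5.14.5) ON THE MODEL WITH THE EXPONENT `exp[−𝒫^L − Σ_X (W₆^{(k)′}(X) + W₆^{(k)″}(X))]` WHERE `W₆′` IS THE PRINTED ONE** —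
the head theorem of row C2.Eq5.14.5 (`BIJ88Eq5145CornerModulus.eq5145_zG_mod_remR_of_ineq5144`: exponent `−𝒫^L − Σ W₆″ − ℛ_k(Λ₁₂)`, display 4
read as the definition of the `W₆′`-sum) KNIT with the sibling `BIJ88W6PrimeVsupp` (`W6v` = `W₆′(X)` as printed; `display4`: `Σ_X W6v X = ℛ_k`):
display 4 is now DERIVED inside the theorem, and the `W₆′` of the exponent carries the printed bound (`BIJ88W6PrimeVsuppBound.ineqW6'_W6v`, r16's
typed leaf `IneqW6'`) — per admissible region `ρ`, for `Λ₁₂ = lam12 W ρ` at the corner `Λ₁₂′ = lam12' adj W ρ`.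

statement-level skeleton of published theorems with citation tags; proofs where landed; nothing here is a claim about the Yang–Mills mass gap

PDF held: `paper:balaban1988-cmp114-bij-abelian-higgs-effective-action` (journal page = PDF page + 256); pp. 310–312 = PDF 54–56 read this generation.

WHAT IS REPRODUCED (unit `lit-balaban-p36`, generation 13 of the Phase-2 proof seat p36, file 7 of the display-4 chain; SKELETON rows
**C2.Eq5.14.5** (member), **C2.Claim@310** (member) of `HOME/lit-balaban-r16/ROWS-C2-part2.md`; owner r16, heads untouched — r16 may re-point):
* **`eq5145_zG_mod_W6v_of_ineq5144`** — (5.14.5) for the corner expectations of the §5.13 Gaussian model, both χ-species of p. 308 (`hmod`), every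
  source `ℱ`, no centring, with the exponent **`exp(−𝒫^L − Σ_{X'} (W₆′_ρ(X') + W₆″_ρ(X')))`**, `W₆′_ρ := W6v` of the region `Λ₁₂ = lam12 W ρ` at
  `1_{Λ₁₂′}` (zero off the sub-regions of `Λ₁₂`, `BIJ88W6PrimeVsuppBound.W6v_eq_zero_of_not_subset`), the sum over ALL `X' : Finset I`; displayed
  per region ONLY: a located slot `s₀`, THE LEAF (5.14.4) for the located data of every sub-region `X' ⊆ Λ₁₂` at every `t ∈ (0,1]` (`h5144`), and
  p. 311 (`h311`: `𝒱 + 𝒫̃ = 𝒫^L + Σ W₆″`).  `hrem` of the head theorem is DISCHARGED by `BIJ88W6PrimeVsupp.remR_sum_Tsum_eq_sum_W6v`.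
* **`ineqW6'_W6v_region`** — for every admissible `ρ`, r16's typed leaf `IneqW6' (cubeSys I) W₆′_ρ (θ^{1−β′}) (β′/(4(1−β′))) n̄` for THAT `W₆′_ρ`
  (the `hW6p` input of r16's `BIJ88IneqW6FromLeaves.ineqW6_of_leaves`), from the leaf for the data of `Λ₁₂` alone.
HONEST SCOPE: (a) (5.14.4) is NOT proved (typed leaf `Ineq5144`, taken for the located data of every sub-region); (b) `W₆″`, `𝒫^L` enter through
`h311` (r16's p. 311 files); (c) the `(n̄+1)!` slip G-C2-p36-06; (d) gen 5's KP-type regime constants and p25's adjusted exponents.  0 `sorry`,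
0 definitions, 0 `Prop` facts (D-0026); imports `BIJ88W6PrimeVsuppBound` (p36 g13); modifies nothing.  NOT summit progress; NOT continuum; NOT Clay.
Cell `lit-balaban` Phase 2, seat p36 gen 13 (row owner r16, referee ref-5).
-/

noncomputable section

open Finset MeasureTheory
open Literature.MathematicalPhysics.QuantumFieldTheory.BalabanImbrieJaffe1984to88.BIJ88DirichletForms305 (interpForm)
open Literature.MathematicalPhysics.QuantumFieldTheory.BalabanImbrieJaffe1984to88.BIJ88PolymerRep5134 (g1 IsAdmissible corner)
open Literature.MathematicalPhysics.QuantumFieldTheory.BalabanImbrieJaffe1984to88.BIJ88PolymerRep5134Gauss (expect zG)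
open Literature.MathematicalPhysics.QuantumFieldTheory.BalabanImbrieJaffe1984to88.BIJ88Resummation5141 (outer lam12)
open Literature.MathematicalPhysics.QuantumFieldTheory.BalabanImbrieJaffe1984to88.BIJ88Resummation5141Adm (lam12')
open Literature.MathematicalPhysics.QuantumFieldTheory.BalabanImbrieJaffe1984to88.BIJ88Expansion5143 (g3 prime)
open Literature.MathematicalPhysics.QuantumFieldTheory.BalabanImbrieJaffe1984to88.BIJ88Expansion5143Gauss (fD)
open Literature.MathematicalPhysics.QuantumFieldTheory.BalabanImbrieJaffe1984to88.BIJ88Expansion5143Ordered (polysOf cvsupp locv wv)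
open Literature.MathematicalPhysics.QuantumFieldTheory.BalabanImbrieJaffe1984to88.BIJ88ConnectedGraphResummation (Tsum)
open Literature.MathematicalPhysics.QuantumFieldTheory.BalabanImbrieJaffe1984to88.BIJ88SlotMomentsGauss308 (uD)
open Literature.MathematicalPhysics.QuantumFieldTheory.BalabanImbrieJaffe1984to88.BIJ88Sect5Statements (CutoffProfile)
open Literature.MathematicalPhysics.QuantumFieldTheory.BalabanImbrieJaffe1984to88.BIJ88Sect5StatementsPart2 (Ineq5144 IneqW6')
open Literature.MathematicalPhysics.QuantumFieldTheory.BalabanImbrieJaffe1984to88.BIJ88Sect5StatementsPart4 (remR pertP)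
open Literature.MathematicalPhysics.QuantumFieldTheory.BalabanImbrieJaffe1984to88.BIJ88Ineq5113Covering (cubeSys)
open Literature.MathematicalPhysics.QuantumFieldTheory.BalabanImbrieJaffe1984to88.BIJ88Eq5145CornerModel (slotB slotY ztIn)
open Literature.MathematicalPhysics.QuantumFieldTheory.BalabanImbrieJaffe1984to88.BIJ88Eq5145CornerUrsell (cubeIn)
open Literature.MathematicalPhysics.QuantumFieldTheory.BalabanImbrieJaffe1984to88.BIJ88Eq5145CornerModulus (eq5145_zG_mod_Tsum_of_ineq5144)
open Literature.MathematicalPhysics.QuantumFieldTheory.BalabanImbrieJaffe1984to88.BIJ88W6PrimeVsupp (actIn W6v remR_sum_Tsum_eq_sum_W6v)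
open Literature.MathematicalPhysics.QuantumFieldTheory.BalabanImbrieJaffe1984to88.BIJ88W6PrimeVsuppBound (W6v_eq_zero_of_not_subset ineqW6'_W6v
  card_filter_cubeIn_le)

namespace Literature.MathematicalPhysics.QuantumFieldTheory.BalabanImbrieJaffe1984to88.BIJ88Eq5145CornerW6

variable {α I : Type} [Fintype α] [DecidableEq α] [Fintype I] [DecidableEq I]
  (blk : α → I) (Δ : Matrix α α ℝ) (ℱ : α → ℝ)
variable (adj : I → I → Prop) [DecidableRel adj]
variable (χ : CutoffProfile) {ι υ : Type*} [DecidableEq ι] [DecidableEq υ]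
variable {p ek : ℝ} {B : Finset ι} {Φ : ι → (α → ℝ) → ℝ} {c : ι → ℝ} {Ys : Finset υ} {V : υ → (α → ℝ) → ℝ}
variable (cube : ↥B ⊕ ↥Ys → I) {L : Type*} (γ : L → ↥B ⊕ ↥Ys)

/-- **(5.14.5) ON THE MODEL WITH `exp[−𝒫^L − Σ_X (W₆^{(k)′}(X) + W₆^{(k)″}(X))]`, `W₆′` AS PRINTED, MODULO THE LEAF (5.14.4)** (p. 311 [PDF 55]:
*"If we put W₆^{(k)}(X) = W₆^{(k)′}(X) + W₆^{(k)″}(X), then W₆^{(k)}(X) obeys …"*; p. 310 display 4 and the sentence defining `W₆′`): the head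
theorem of row C2.Eq5.14.5 (`BIJ88Eq5145CornerModulus.eq5145_zG_mod_Tsum_of_ineq5144`, index set `𝒳 := univ : Finset (Finset I)`) with
`W6p ρ := W6v` of `Λ₁₂ = lam12 W ρ` at `1_{lam12' adj W ρ}` and its `hrem` DISCHARGED by display 4 derived (`BIJ88W6PrimeVsupp.remR_sum_Tsum_eq_sum_W6v`;
`W6v` vanishes off the sub-regions of `Λ₁₂`).  Hypotheses: gen 5's regime, `Δ ≻ 0` coupling abutting cubes only, `χ ≥ 0`, `p > 1/2`, linear-or-modulus
cube-local slot fields (`hmod`), `c_b ≥ c₀ > 0`, measurable bounded cube-local terms, `0 < e_k < e^{−1}`, cube-local `F`, `|L'| = n̄+1`; per region: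
`s₀`, the leaf for the located data of EVERY SUB-REGION of `Λ₁₂` at every `t ∈ (0,1]`, `h311`.
[cite: BalabanImbrieJaffe1988, (5.14.5) p.312; p.310 display 4; (5.14.2) p.308; (5.14.4) p.309; p.311] -/
theorem eq5145_zG_mod_W6v_of_ineq5144 {nbr : I → Finset I} {D : ℕ} {θ β' : ℝ} (hR : ∀ x y, adj x y → adj y x)
    (hD : ∀ x, (nbr x).card ≤ D) (hnbr : ∀ x y, adj x y → y ∈ nbr x) (hθ0 : 0 < θ) (hθ1 : θ ≤ 1) (hβ : 0 ≤ β')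
    (hsmall : 16 * ((D : ℝ) + 1) ^ 2 * (θ ^ (β' / 2) * Real.exp 2) ≤ 1)
    (hΔadj : ∀ x y, blk x ≠ blk y → ¬ adj (blk x) (blk y) → Δ x y = 0) (hΔ : Δ.PosDef)
    (hχ : ∀ x, 0 ≤ χ.χ₁ x) (hp : 1 / 2 < p)
    (hmod : ∀ b ∈ B, ∃ ℓ₁ ℓ₂ : (α → ℝ) → ℝ, IsLinearMap ℝ ℓ₁ ∧ IsLinearMap ℝ ℓ₂ ∧
      ((∀ φ, Φ b φ = ℓ₁ φ) ∨ (∀ φ, Φ b φ = Real.sqrt (ℓ₁ φ ^ 2 + ℓ₂ φ ^ 2))))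
    {c₀ : ℝ} (hc₀ : 0 < c₀) (hcb : ∀ b ∈ B, c₀ ≤ c b) (hV : ∀ Y ∈ Ys, Measurable (V Y)) {KY : υ → ℝ} (hK : ∀ Y ∈ Ys, ∀ φ, |V Y φ| ≤ KY Y)
    (hek : 0 < ek) (hek1 : ek < Real.exp (-1))
    (hΦloc : ∀ b : B, ∀ φ ψ : α → ℝ, (∀ x, blk x = cube (Sum.inl b) → φ x = ψ x) → Φ b φ = Φ b ψ)
    (hVloc : ∀ Y : Ys, ∀ φ ψ : α → ℝ, (∀ x, blk x = cube (Sum.inr Y) → φ x = ψ x) → V Y φ = V Y ψ)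
    (F : I → (α → ℝ) → ℝ) (hFloc : ∀ i (φ ψ : α → ℝ), (∀ x, blk x = i → φ x = ψ x) → F i φ = F i ψ)
    {L' : Type} [Fintype L'] [DecidableEq L'] {nbar : ℕ} (hL : Fintype.card L' = nbar + 1)
    (W Bl : Finset I) (Vconst PL : ℝ) (W6pp : Finset (Finset I) → Finset I → ℝ)
    (s₀ : (ρ : Finset (Finset I)) → ↥(slotB B Ys cube (lam12 W ρ)) ⊕ ↥(slotY B Ys cube (lam12 W ρ)))
    (h5144 : ∀ ρ ∈ (outer W Bl).filter (IsAdmissible adj), ∀ X' ⊆ lam12 W ρ, ∀ t ∈ Set.Ioc (0 : ℝ) 1,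
      ∀ γ' : L' → ↥(slotB B Ys cube X') ⊕ ↥(slotY B Ys cube X'),
      Ineq5144 (cubeSys I) (Finset L') (actIn blk Δ ℱ adj χ p ek B Φ c Ys V cube (lam12' adj W ρ) X' t γ')
        Finset.card (fun H (X'' : Finset I) => (X'' \ H.image (cubeIn cube X' ∘ γ')).card) θ β')
    (h311 : ∀ ρ ∈ (outer W Bl).filter (IsAdmissible adj),
      Vconst + pertP (fun t => Real.log (ztIn blk Δ ℱ χ p ek B Φ c Ys V cube (lam12 W ρ) (lam12' adj W ρ) t)) nbar =
        PL + ∑ X' : Finset I, W6pp ρ X') :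
    Real.exp (-Vconst) * expect blk Δ ℱ (fun i φ => fD (uD χ p ek B Φ c Ys V 1) cube γ ∅ i φ * F i φ) W (corner ℝ W) =
      ∑ ρ ∈ (outer W Bl).filter (IsAdmissible adj),
        (∏ X ∈ ρ, g1 adj (zG blk Δ ℱ (fun i φ => fD (uD χ p ek B Φ c Ys V 1) cube γ ∅ i φ * F i φ)) X) *
          (zG blk Δ ℱ (fun i φ => fD (uD χ p ek B Φ c Ys V 1) cube γ ∅ i φ * F i φ) (lam12 W ρ) (lam12' adj W ρ) /
              zG blk Δ ℱ (fD (uD χ p ek B Φ c Ys V 1) cube γ ∅) (lam12 W ρ) (lam12' adj W ρ) *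
            Real.exp (-PL - ∑ X' : Finset I,
              (W6v blk Δ ℱ adj χ p ek B Φ c Ys V cube (lam12' adj W ρ) (lam12 W ρ) L' nbar X' + W6pp ρ X'))) :=
  eq5145_zG_mod_Tsum_of_ineq5144 blk Δ ℱ adj χ cube γ hR hD hnbr hθ0 hθ1 hβ hsmall hΔadj hΔ hχ hp hmod hc₀ hcb hV hK hek hek1 hΦloc hVloc
    F hFloc hL W Bl (univ : Finset (Finset I)) Vconst PL (fun ρ X' => W6v blk Δ ℱ adj χ p ek B Φ c Ys V cube (lam12' adj W ρ) (lam12 W ρ) L' nbar X')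
    W6pp s₀ (fun ρ hρ t ht γ' => h5144 ρ hρ (lam12 W ρ) Subset.rfl t ht γ') (fun ρ hρ => by
      rw [remR_sum_Tsum_eq_sum_W6v blk Δ ℱ adj χ (lam12' adj W ρ) hR hD hnbr hθ0 hθ1 hβ hsmall hχ hp hΔadj hΔ hΦloc hVloc hmod hc₀ hcb hV hK
        hek hek1 (lam12 W ρ) L' hL (h5144 ρ hρ)]
      exact sum_subset (subset_univ _) fun X' _ hX' =>
        W6v_eq_zero_of_not_subset blk Δ ℱ adj χ (lam12' adj W ρ) (fun h => hX' (mem_powerset.2 h)) L' nbar) h311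

/-- **THE PRINTED BOUND FOR THE `W₆′` OF EVERY REGION, MODULO (5.14.4)**: for every admissible `ρ`, r16's typed leaf
`IneqW6' (cubeSys I) W₆′_ρ (θ^{1−β′}) (β′/(4(1−β′))) n̄` for the `W₆′_ρ = W6v` of the previous theorem's exponent (`BIJ88W6PrimeVsuppBound.ineqW6'_W6v`
for `W₀ = lam12 W ρ`, `Λ = lam12' adj W ρ`): at most `G` slots (χ-slots `b ∈ B` and terms `Y ∈ Ys` of p. 308 together) per cube, `β′ < 1`, the
absorption condition, the leaf for the data of `Λ₁₂` at every `t ∈ (0,1]` — the `hW6p` input of r16's `BIJ88IneqW6FromLeaves.ineqW6_of_leaves` (p. 311). [cite: BalabanImbrieJaffe1988, p.310 (Sect. 5.14); (5.14.4) p.309; p.311] -/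
theorem ineqW6'_W6v_region {nbr : I → Finset I} {D : ℕ} {θ β' : ℝ} (hR : ∀ x y, adj x y → adj y x)
    (hD : ∀ x, (nbr x).card ≤ D) (hnbr : ∀ x y, adj x y → y ∈ nbr x) (hθ0 : 0 < θ) (hθ1 : θ ≤ 1) (hβ : 0 ≤ β') (hβ1 : β' < 1)
    (hsmall : 16 * ((D : ℝ) + 1) ^ 2 * (θ ^ (β' / 2) * Real.exp 2) ≤ 1) [Fintype ι] [Fintype υ] {G : ℕ}
    (hG : ∀ i, (univ.filter fun τ : ↥B ⊕ ↥Ys => cube τ = i).card ≤ G)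
    {L' : Type} [Fintype L'] [DecidableEq L'] {nbar : ℕ} (hL : Fintype.card L' = nbar + 1)
    (habs : 4 * Real.exp 2 * θ ^ (β' / 2) * ((D : ℝ) + 1) * (nbar + 1 : ℝ) * (G : ℝ) ^ (nbar + 1) * (nbar + 2).factorial ≤
      (β' / 4 * Real.log θ⁻¹) ^ (nbar + 2))
    (W Bl : Finset I)
    (h5144 : ∀ ρ ∈ (outer W Bl).filter (IsAdmissible adj), ∀ t ∈ Set.Ioc (0 : ℝ) 1,
      ∀ γ' : L' → ↥(slotB B Ys cube (lam12 W ρ)) ⊕ ↥(slotY B Ys cube (lam12 W ρ)),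
      Ineq5144 (cubeSys I) (Finset L') (actIn blk Δ ℱ adj χ p ek B Φ c Ys V cube (lam12' adj W ρ) (lam12 W ρ) t γ')
        Finset.card (fun H (X'' : Finset I) => (X'' \ H.image (cubeIn cube (lam12 W ρ) ∘ γ')).card) θ β') :
    ∀ ρ ∈ (outer W Bl).filter (IsAdmissible adj),
      IneqW6' (cubeSys I) (W6v blk Δ ℱ adj χ p ek B Φ c Ys V cube (lam12' adj W ρ) (lam12 W ρ) L' nbar) (θ ^ (1 - β'))
        (β' / (4 * (1 - β'))) nbar :=
  fun ρ hρ => ineqW6'_W6v blk Δ ℱ adj χ (lam12' adj W ρ) hR hD hnbr hθ0 hθ1 hβ hβ1 hsmall (lam12 W ρ)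
    (fun i => (card_filter_cubeIn_le (cube := cube) (lam12 W ρ) i).trans (hG i)) L' hL habs (h5144 ρ hρ)

end Literature.MathematicalPhysics.QuantumFieldTheory.BalabanImbrieJaffe1984to88.BIJ88Eq5145CornerW6

end
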